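import Literature.AnabelianGeometry.EtaleTheta.SettingModelChiKummerData
import Literature.AnabelianGeometry.EtaleTheta.SettingModelChiThetaCocycle
import Literature.AnabelianGeometry.EtaleTheta.SettingModelChiProp15ii
import HarnessLib

/-!
# The χ-twisted root model of [EtTh] §1 (R78 (B)): the `z`-COORDINATE CLASS on `(Π^tp_Y)^Θ` — the model's
# `η^Θ` "without denominators", restricting to `log(Θ)` on `Δ_Θ`

S. Mochizuki, *The étale theta function and its Frobenioid-theoretic manifestations*, Publ. RIMS **45** (2009)
[EtTh], §1, Prop. 1.3 p. 20 ("`η̈^Θ ∈ H¹(Π^tp_Ÿ, Δ_Θ)`"), Prop. 1.5 (i)–(iii) p. 23 ("`F⁰/F¹ = Hom(Δ_Θ, Δ_Θ) = Ẑ·log(Θ)`",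
"we use the symbol `log(Θ)` to denote the identity morphism `Δ_Θ → Δ_Θ`", "any class `η̈^Θ ∈ H¹(Π^tp_Ÿ, Δ_Θ)` arises
from a unique class `η̈^Θ ∈ H¹((Π^tp_Ÿ)^Θ, Δ_Θ)` that maps to `log(Θ)` in the quotient `F̈⁰/F̈¹`")
[cite: MochizukiEtTh2009, Prop 1.5 p.23]. Layer L2 of the abc-iut cell, seat abc-iut-L2-t6 (gen 6), R78 cluster hand
#4 (file map R100, F7: the class `η̈♯ := z`-class announced 06:05Z) — over abc-iut-L2-t1's F5b `ThetaSetting.modelχ p`,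
abc-iut-L6-d6's F1c `SettingModelChiDeltaTheta` (`cThetaχ`, `deltaThetaCoordχ`, `conj_cThetaχ`,
`exists_cThetaχ_eq_of_mem_ker`, `hHat_eq_of_toTheta_eq_cThetaχ`), abc-iut-w5-d171's F6 `SettingModelChiKummerData`
(`yCoordχ`/`yThetaχ`, `yThetaχ_mul`, `hHat_y_eq_zero_iff`), abc-iut-w5-d029's `bPowGfp`, abc-iut-w5-d249's F4
(`PiTpχ`, `actχ`, `isInducing_leftRightχ`) and abc-iut-L2-d1's hand #2″ `SettingModelChiThetaCocycle` (the model's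
theta cocycle ON `Π^tp_Y`: `centreRep`, `etaχ`, `etaDdχ`) and abc-iut-L6-d5's `SettingModelChiProp15ii`
(`yThetaχ_eq_one_of_mem_deltaTheta`; there the lift of `log(Θ)` is an `∃` inside a proof — here it is NAMED and tied
to `etaDdχ`) — consumed BY NAME, nothing restated. Class (b) CONSTRUCTION over the
frozen interface (three definitions: `refLiftχ`, `zFunχ`, `zClassχ`; no instance, no notation, no `Prop` fact).

WHAT. In `Π^tp_X = Γ ⋊_χ G_{ℚ_p}` (`Γ = F̂₂ ×_Ẑ ℤ`) an element of `Π^tp_Y = Ker(Π^tp_X ↠ ℤ)` has `Γ`-part of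
`a`-exponent `0`, so modulo `[[F̂₂,F̂₂],F̂₂]⁻` it is `b^y c^z` (`c = [a,b]`, `Δ_Θ = c^Ẑ`). The `y`-coordinate and the
augmentation assemble into the CONTINUOUS HOMOMORPHISM **`refLiftχ : (Π^tp_X)^Θ → (Π^tp_X)^Θ`, `h ↦ θ⟨b^{ŷ(h)}, aug^Θ h⟩`**
(a homomorphism by the crossed law `ŷ(hk) = ŷ(h) + χ(aug^Θ h)·ŷ(k)` and `σ·b^t·σ⁻¹ = b^{χ(σ)t}`); the **`z`-part**
`zPartχ h := h · refLiftχ(h)⁻¹` lies in `Δ_Θ` for `h ∈ (Π^tp_Y)^Θ` (`zPartχ_mem_deltaTheta`: degree `0` kills the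
`x`-level, `ŷ` cancels the `y`-level) and is the identity on `Δ_Θ` (`zPartχ_eq_of_mem_deltaTheta`: `ŷ` and `aug^Θ`
vanish there). Since conjugation on `Δ_Θ ≅ Ẑ(χ)` factors through `aug^Θ` (`conj_cThetaχ`) and
`aug^Θ ∘ refLiftχ = aug^Θ`, `h ↦ zPartχ h` is a continuous `1`-COCYCLE on every `H ≤ (Π^tp_Y)^Θ` (`zFunχ_mem`):
**`zClassχ H hH ∈ H¹(H, Δ_Θ)`**, with **`res_{Δ_Θ} zClassχ = log(Θ)`** (`res_zClassχ_eq_logTheta`) — a LIFT of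
`log(Θ)` to `(Π^tp_Y)^Θ` / `(Π^tp_Ÿ)^Θ` (`zClassYχ`, `zClassYddχ`); and **JUNCTION with abc-iut-L2-d1's theta class of
the model**: `infl zClassYχ = etaχ`, `infl zClassYddχ = etaDdχ` (`inflTheta_zClassYχ`, `inflTheta_zClassYddχ` — the two
cocycles agree on the nose: `g·⟨b^{ŷ(g)}, g.right⟩⁻¹ = inl(centreRep g.left)`), so L2-d1's `η̈^Θ` "arises from" a
class on `(Π^tp_Ÿ)^Θ` restricting to `log(Θ)` — the EXISTENCE half of the first clause of Prop. 1.5 (iii) at the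
model's own theta class (`exists_lift_etaDdχ`); input of the Prop. 1.5 (i)/(ii) census via abc-iut-L2-t6's
`prop15ii_res_surjective_of_lift`, and of F7q.

HONEST FRAMING: SEMI-SYNTHETIC model (the χ-twisted root; not the tempered `π₁` of a curve, no theta FUNCTION — the
class is the group-theoretic shadow of the divisor of `Θ̈`, not a Kummer class of a function) — consistency /
non-vacuity evidence for the typed interface ONLY; nothing of [EtTh] is asserted; typed ≠ proved; no side is taken
on [IUTchIII] Cor. 3.12.
-/

noncomputable section

namespace Literature.AnabelianGeometry.EtaleTheta.SettingModel

open Literature.AnabelianGeometry.SemiGraphs _root_.Topology _root_.Function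

variable (p : ℕ) [Fact p.Prime]

/-! ### The `y`-coordinate on `Δ_Θ` and at `1` -/

/-- `ŷ(1) = 0`. [cite: MochizukiEtTh2009, Prop 1.5 p.23] -/
theorem yThetaχ_one : yThetaχ p 1 = 1 := by
  rw [← map_one (CurveTheta.toTheta (curveχ p)), yThetaχ_toTheta]
  show eHatB (gfpFst (1 : PiTpχ p).left) = 1
  rw [SemidirectProduct.one_left, map_one, map_one]

/-- `aug^Θ` vanishes on `Δ_Θ` (`Δ_Θ ≤ (Δ^tp_X)^Θ`). [cite: MochizukiEtTh2009, §1 p.12] -/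
theorem augTheta_eq_one_of_mem_deltaTheta {d : CurveTheta.GTheta (curveχ p)}
    (hd : d ∈ (CurveTheta.thetaToEll (curveχ p)).ker) : CurveTheta.augTheta (curveχ p) d = 1 := by
  obtain ⟨t, rfl⟩ := exists_cThetaχ_eq_of_mem_ker p hd
  rw [cThetaχ_apply, CurveTheta.augTheta_toTheta]
  rfl

/-! ### The reference lift `h ↦ θ⟨b^{ŷ(h)}, aug^Θ h⟩` -/

/-- The `b`-axis representative `⟨b^{ŷ(h)}, aug^Θ h⟩ ∈ Π^tp_X` of `h ∈ (Π^tp_X)^Θ`. [cite: MochizukiEtTh2009, Prop 1.5 p.23] -/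
def refReprχ (h : CurveTheta.GTheta (curveχ p)) : PiTpχ p :=
  ⟨bPowGfp (yThetaχ p h), CurveTheta.augTheta (curveχ p) h⟩

/-- [cite: MochizukiEtTh2009, Prop 1.5 p.23] -/
@[simp] theorem refReprχ_left (h : CurveTheta.GTheta (curveχ p)) : (refReprχ p h).left = bPowGfp (yThetaχ p h) := rfl

/-- [cite: MochizukiEtTh2009, Prop 1.5 p.23] -/
@[simp] theorem refReprχ_right (h : CurveTheta.GTheta (curveχ p)) :
    (refReprχ p h).right = CurveTheta.augTheta (curveχ p) h := rfl

/-- `refReprχ` is multiplicative: the crossed law `ŷ(hk) = ŷ(h)·χ(aug^Θ h)(ŷ(k))` matches the semidirect law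
`⟨b^s, σ⟩⟨b^t, τ⟩ = ⟨b^{s + χ(σ)t}, στ⟩`. [cite: MochizukiEtTh2009, Prop 1.5 p.23] -/
theorem refReprχ_mul (h k : CurveTheta.GTheta (curveχ p)) : refReprχ p (h * k) = refReprχ p h * refReprχ p k := by
  refine SemidirectProduct.ext ?_ ?_
  · rw [SemidirectProduct.mul_left, refReprχ_left, refReprχ_left, refReprχ_left, refReprχ_right, yThetaχ_mul,
      map_mul, actχ_apply, twistGfp_bPowGfp]
  · rw [SemidirectProduct.mul_right, refReprχ_right, refReprχ_right, refReprχ_right, map_mul]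

/-- `refReprχ 1 = 1`. [cite: MochizukiEtTh2009, Prop 1.5 p.23] -/
theorem refReprχ_one : refReprχ p 1 = 1 := by
  refine SemidirectProduct.ext ?_ ?_
  · rw [refReprχ_left, yThetaχ_one, map_one, SemidirectProduct.one_left]
  · rw [refReprχ_right, map_one, SemidirectProduct.one_right]

/-- `refReprχ` is continuous. [cite: MochizukiEtTh2009, Prop 1.5 p.23] -/
theorem continuous_refReprχ : Continuous (refReprχ p) :=
  (Semidirect.continuous_iff_left_right (isInducing_leftRightχ p)).2
    ⟨bPowGfp.continuous.comp (continuous_yThetaχ p), CurveTheta.continuous_augTheta (curveχ p)⟩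

/-- **The reference lift** `refLiftχ : (Π^tp_X)^Θ → (Π^tp_X)^Θ`, `h ↦ θ⟨b^{ŷ(h)}, aug^Θ h⟩` — a continuous
endomorphism recording the `y`-coordinate and the Galois part and forgetting the `z`-coordinate.
[cite: MochizukiEtTh2009, Prop 1.5 p.23] -/
def refLiftχ : CurveTheta.GTheta (curveχ p) →* CurveTheta.GTheta (curveχ p) where
  toFun h := CurveTheta.toTheta (curveχ p) (refReprχ p h)
  map_one' := by rw [refReprχ_one, map_one]
  map_mul' h k := by rw [refReprχ_mul, map_mul]

/-- [cite: MochizukiEtTh2009, Prop 1.5 p.23] -/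
theorem refLiftχ_apply (h : CurveTheta.GTheta (curveχ p)) :
    refLiftχ p h = CurveTheta.toTheta (curveχ p) (refReprχ p h) := rfl

/-- `refLiftχ` is continuous. [cite: MochizukiEtTh2009, Prop 1.5 p.23] -/
theorem continuous_refLiftχ : Continuous (refLiftχ p) :=
  (CurveTheta.continuous_toTheta (curveχ p)).comp (continuous_refReprχ p)

/-- `aug^Θ ∘ refLiftχ = aug^Θ`. [cite: MochizukiEtTh2009, Prop 1.5 p.23] -/
theorem augTheta_refLiftχ (h : CurveTheta.GTheta (curveχ p)) :
    CurveTheta.augTheta (curveχ p) (refLiftχ p h) = CurveTheta.augTheta (curveχ p) h := by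
  rw [refLiftχ_apply, CurveTheta.augTheta_toTheta]
  rfl

/-- `refLiftχ` kills `Δ_Θ`. [cite: MochizukiEtTh2009, Prop 1.5 p.23] -/
theorem refLiftχ_eq_one_of_mem_deltaTheta {d : CurveTheta.GTheta (curveχ p)}
    (hd : d ∈ (CurveTheta.thetaToEll (curveχ p)).ker) : refLiftχ p d = 1 := by
  rw [refLiftχ_apply, ← map_one (CurveTheta.toTheta (curveχ p))]
  congr 1
  refine SemidirectProduct.ext ?_ ?_
  · rw [refReprχ_left, yThetaχ_eq_one_of_mem_deltaTheta p hd, map_one, SemidirectProduct.one_left]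
  · rw [refReprχ_right, augTheta_eq_one_of_mem_deltaTheta p hd, SemidirectProduct.one_right]

/-- **Conjugation on `Δ_Θ` through `refLiftχ`**: `g d g⁻¹ = r(g) d r(g)⁻¹` for `d ∈ Δ_Θ` (both act through `χ ∘ aug^Θ`).
[cite: MochizukiEtTh2009, §1 p.12] -/
theorem conj_eq_conj_refLiftχ (g : CurveTheta.GTheta (curveχ p)) {d : CurveTheta.GTheta (curveχ p)}
    (hd : d ∈ (CurveTheta.thetaToEll (curveχ p)).ker) : g * d * g⁻¹ = refLiftχ p g * d * (refLiftχ p g)⁻¹ := by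
  obtain ⟨t, rfl⟩ := exists_cThetaχ_eq_of_mem_ker p hd
  rw [conj_cThetaχ, conj_cThetaχ, augTheta_refLiftχ]

/-! ### The `z`-part of an element of `(Π^tp_Y)^Θ` -/

/-- **The `z`-part** `zPartχ h := h · refLiftχ(h)⁻¹`. [cite: MochizukiEtTh2009, Prop 1.5 p.23] -/
def zPartχ (h : CurveTheta.GTheta (curveχ p)) : CurveTheta.GTheta (curveχ p) := h * (refLiftχ p h)⁻¹

/-- [cite: MochizukiEtTh2009, Prop 1.5 p.23] -/
theorem zPartχ_def (h : CurveTheta.GTheta (curveχ p)) : zPartχ p h = h * (refLiftχ p h)⁻¹ := rfl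

/-- `zPartχ` is continuous. [cite: MochizukiEtTh2009, Prop 1.5 p.23] -/
theorem continuous_zPartχ : Continuous (zPartχ p) := continuous_id.mul (continuous_refLiftχ p).inv

/-- The representative `g · ⟨b^{ŷ(g)}, g.right⟩⁻¹` of the `z`-part of `θ(g)` is `inl(g.left · b^{−ŷ(g)})`.
[cite: MochizukiEtTh2009, Prop 1.5 p.23] -/
theorem mul_refReprχ_inv_eq_inl (g : PiTpχ p) :
    g * (refReprχ p (CurveTheta.toTheta (curveχ p) g))⁻¹ =
      SemidirectProduct.inl (g.left * (bPowGfp (yCoordχ p g))⁻¹) := by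
  refine SemidirectProduct.ext ?_ ?_
  · rw [SemidirectProduct.mul_left, SemidirectProduct.inv_left, refReprχ_left, refReprχ_right, yThetaχ_toTheta,
      CurveTheta.augTheta_toTheta, SemidirectProduct.left_inl, ← MulAut.mul_apply, ← map_mul]
    change g.left * actχ p (g.right * g.right⁻¹) (bPowGfp (yCoordχ p g))⁻¹ = _
    rw [mul_inv_cancel, map_one, MulAut.one_apply]
  · rw [SemidirectProduct.mul_right, SemidirectProduct.inv_right, refReprχ_right, CurveTheta.augTheta_toTheta,
      SemidirectProduct.right_inl]
    exact mul_inv_cancel _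

/-- **The `z`-part of an element of `(Π^tp_Y)^Θ` lies in `Δ_Θ`**: for `g ∈ Π^tp_Y` (degree `0`) the element
`g.left · b^{−ŷ(g)} ∈ Γ` has all level `x`- and `y`-coordinates `0`, i.e. lies over `[F̂₂,F̂₂]⁻`.
[cite: MochizukiEtTh2009, Prop 1.5 p.23] -/
theorem zPartχ_mem_deltaTheta {h : CurveTheta.GTheta (curveχ p)}
    (hh : h ∈ (ThetaSetting.modelχ p).GtpY.map (ThetaSetting.modelχ p).toTheta) :
    zPartχ p h ∈ (ThetaSetting.modelχ p).DeltaTheta := by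
  obtain ⟨g, hg, rfl⟩ := hh
  have hg0 : gfpSnd g.left = 1 := by
    have h' : (chiTwistData p).toZ g = 1 := hg
    rwa [GfpTwistData.toZ_apply] at h'
  change CurveTheta.toTheta (curveχ p) g * (CurveTheta.toTheta (curveχ p) (refReprχ p _))⁻¹ ∈
    (CurveTheta.thetaToEll (curveχ p)).ker
  rw [← map_inv, ← map_mul, mul_refReprχ_inv_eq_inl, CurveTheta.mk_mem_ker_thetaToEll_iff, mem_ellKerχ_iff]
  refine ⟨fun N => ?_, SemidirectProduct.right_inl _⟩
  rw [SemidirectProduct.left_inl, map_mul, map_inv, map_mul, map_inv, gfpFst_bPowGfp, hHat_bPow]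
  have hx : (hHat N (gfpFst g.left)).x = 0 := levelHom_x_eq_zero hg0
  have hy : (hHat N (gfpFst g.left)).y = Multiplicative.toAdd (ZHatLevel.level N (yCoordχ p g)) := by
    rw [← modN_eq_level, show yCoordχ p g = eHatB (gfpFst g.left) from rfl, ← hHat_y_eq_modN_eHatB, toAdd_ofAdd]
  refine ⟨?_, ?_⟩
  · rw [Heis.mul_x, Heis.inv_x, hx]
    simp
  · rw [Heis.mul_y, Heis.inv_y, hy]
    simp

/-- **The `z`-part is the identity on `Δ_Θ`** (`refLiftχ` kills `Δ_Θ`). [cite: MochizukiEtTh2009, Prop 1.5 p.23] -/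
theorem zPartχ_eq_of_mem_deltaTheta {d : CurveTheta.GTheta (curveχ p)}
    (hd : d ∈ (CurveTheta.thetaToEll (curveχ p)).ker) : zPartχ p d = d := by
  rw [zPartχ_def, refLiftχ_eq_one_of_mem_deltaTheta p hd, inv_one, mul_one]

/-- **The cocycle identity** `z(gh) = z(g) · g z(h) g⁻¹` on `(Π^tp_Y)^Θ` (conjugation on `Δ_Θ` through `refLiftχ`,
which is a homomorphism). [cite: MochizukiEtTh2009, Prop 1.5 p.23] -/
theorem zPartχ_mul {g h : CurveTheta.GTheta (curveχ p)}
    (hh : h ∈ (ThetaSetting.modelχ p).GtpY.map (ThetaSetting.modelχ p).toTheta) :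
    zPartχ p (g * h) = zPartχ p g * (g * zPartχ p h * g⁻¹) := by
  rw [conj_eq_conj_refLiftχ p g (zPartχ_mem_deltaTheta p hh), zPartχ_def, zPartχ_def, zPartχ_def, map_mul,
    mul_inv_rev]
  group

/-! ### The `z`-class -/

/-- **The `z`-coordinate cocycle** on a subgroup `H ≤ (Π^tp_Y)^Θ`, valued in `Δ_Θ(modelχ)`. [cite: MochizukiEtTh2009, Prop 1.5 p.23] -/
def zFunχ (H : Subgroup (CurveTheta.GTheta (curveχ p)))
    (hH : H ≤ (ThetaSetting.modelχ p).GtpY.map (ThetaSetting.modelχ p).toTheta) :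
    H → (ThetaSetting.modelχ p).DeltaTheta :=
  fun h => ⟨zPartχ p h, zPartχ_mem_deltaTheta p (hH h.2)⟩

/-- [cite: MochizukiEtTh2009, Prop 1.5 p.23] -/
@[simp] theorem coe_zFunχ (H : Subgroup (CurveTheta.GTheta (curveχ p)))
    (hH : H ≤ (ThetaSetting.modelχ p).GtpY.map (ThetaSetting.modelχ p).toTheta) (h : H) :
    ((zFunχ p H hH h : (ThetaSetting.modelχ p).DeltaTheta) : CurveTheta.GTheta (curveχ p)) = zPartχ p h := rfl

/-- **It is a continuous `1`-cocycle** for the conjugation action of `(Π^tp_X)^Θ` on `Δ_Θ`. [cite: MochizukiEtTh2009, Prop 1.5 p.23] -/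
theorem zFunχ_mem (H : Subgroup (CurveTheta.GTheta (curveχ p)))
    (hH : H ≤ (ThetaSetting.modelχ p).GtpY.map (ThetaSetting.modelχ p).toTheta) :
    zFunχ p H hH ∈ contCocycles (MonoidHom.id (CurveTheta.GTheta (curveχ p))) (ThetaSetting.modelχ p).DeltaTheta H := by
  refine ⟨((continuous_zPartχ p).comp continuous_subtype_val).subtype_mk _, fun g h => Subtype.ext ?_⟩
  change zPartχ p ((g : CurveTheta.GTheta (curveχ p)) * h) =
    zPartχ p g * ((g : CurveTheta.GTheta (curveχ p)) * zPartχ p h * (g : CurveTheta.GTheta (curveχ p))⁻¹)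
  exact zPartχ_mul p (hH h.2)

/-- **The `z`-class `∈ H¹(H, Δ_Θ)`** for `H ≤ (Π^tp_Y)^Θ` — the model's class "without denominators".
[cite: MochizukiEtTh2009, Prop 1.5 p.23] -/
def zClassχ (H : Subgroup (CurveTheta.GTheta (curveχ p)))
    (hH : H ≤ (ThetaSetting.modelχ p).GtpY.map (ThetaSetting.modelχ p).toTheta) : (ThetaSetting.modelχ p).H1Theta H :=
  ContH1.mk (zFunχ p H hH) (zFunχ_mem p H hH)

/-- [cite: MochizukiEtTh2009, Prop 1.5 p.23] -/
theorem zClassχ_def (H : Subgroup (CurveTheta.GTheta (curveχ p)))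
    (hH : H ≤ (ThetaSetting.modelχ p).GtpY.map (ThetaSetting.modelχ p).toTheta) :
    zClassχ p H hH = ContH1.mk (zFunχ p H hH) (zFunχ_mem p H hH) := rfl

/-- The `z`-classes are compatible under restriction. [cite: MochizukiEtTh2009, Prop 1.5 p.23] -/
theorem res_zClassχ {H H' : Subgroup (CurveTheta.GTheta (curveχ p))}
    (hH : H ≤ (ThetaSetting.modelχ p).GtpY.map (ThetaSetting.modelχ p).toTheta) (hle : H' ≤ H) :
    ContH1.res (MonoidHom.id (CurveTheta.GTheta (curveχ p))) (ThetaSetting.modelχ p).DeltaTheta hle (zClassχ p H hH) =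
      zClassχ p H' (hle.trans hH) := by
  change ContH1.mk _ _ = ContH1.mk _ _
  exact ContH1.mk_congr _ (funext fun h => rfl) _ _

/-- **`res_{Δ_Θ}(z-class) = log(Θ)`**: on `Δ_Θ` the `z`-cocycle is the identity — the `z`-class "maps to `log(Θ)` in
the quotient `F⁰/F¹ = Hom(Δ_Θ, Δ_Θ)`". [cite: MochizukiEtTh2009, Prop 1.5 (iii) p.23] -/
theorem res_zClassχ_eq_logTheta {H : Subgroup (CurveTheta.GTheta (curveχ p))}
    (hH : H ≤ (ThetaSetting.modelχ p).GtpY.map (ThetaSetting.modelχ p).toTheta)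
    (hle : (ThetaSetting.modelχ p).DeltaTheta ≤ H) :
    ContH1.res (MonoidHom.id (CurveTheta.GTheta (curveχ p))) (ThetaSetting.modelχ p).DeltaTheta hle (zClassχ p H hH) =
      (ThetaSetting.modelχ p).logTheta := by
  change ContH1.mk _ _ = ContH1.mk _ _
  exact ContH1.mk_congr _ (funext fun d => Subtype.ext (zPartχ_eq_of_mem_deltaTheta p d.2)) _ _

/-! ### On `(Π^tp_Y)^Θ`, `(Π^tp_Ÿ)^Θ`; the class `η̈♯` on `Π^tp_Ÿ` -/

/-- The `z`-class on `(Π^tp_Y)^Θ` — a lift of `log(Θ)` to `F⁰ = H¹((Π^tp_Y)^Θ, Δ_Θ)`. [cite: MochizukiEtTh2009, Prop 1.5 (i) p.23] -/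
def zClassYχ : (ThetaSetting.modelχ p).H1Theta ((ThetaSetting.modelχ p).GtpY.map (ThetaSetting.modelχ p).toTheta) :=
  zClassχ p _ le_rfl

/-- The `z`-class on `(Π^tp_Ÿ)^Θ` — a lift of `log(Θ)` to `F̈⁰ = H¹((Π^tp_Ÿ)^Θ, Δ_Θ)`. [cite: MochizukiEtTh2009, Prop 1.5 (ii) p.23] -/
def zClassYddχ : (ThetaSetting.modelχ p).H1Theta ((ThetaSetting.modelχ p).GtpYdd.map (ThetaSetting.modelχ p).toTheta) :=
  zClassχ p _ (Subgroup.map_mono (ThetaSetting.modelχ p).GtpYdd_le_GtpY)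

/-- `zClassYχ|_{(Π^tp_Ÿ)^Θ} = zClassYddχ`. [cite: MochizukiEtTh2009, Prop 1.5 p.23] -/
theorem res_zClassYχ : ContH1.res (MonoidHom.id (CurveTheta.GTheta (curveχ p))) (ThetaSetting.modelχ p).DeltaTheta
    (ThetaSetting.modelχ p).GtpYddTheta_le (zClassYχ p) = zClassYddχ p :=
  res_zClassχ p _ _

/-- **`res_{Δ_Θ} zClassYχ = log(Θ)`** (`F⁰ → F⁰/F¹` hits `log(Θ)`). [cite: MochizukiEtTh2009, Prop 1.5 (i) p.23] -/
theorem res_zClassYχ_eq_logTheta (hC : (ThetaSetting.modelχ p).Compat) :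
    ContH1.res (MonoidHom.id (CurveTheta.GTheta (curveχ p))) (ThetaSetting.modelχ p).DeltaTheta
      (hC.deltaTheta_le_DtpYTheta.trans (Subgroup.map_mono inf_le_left)) (zClassYχ p) = (ThetaSetting.modelχ p).logTheta :=
  res_zClassχ_eq_logTheta p _ _

/-- **`res_{Δ_Θ} zClassYddχ = log(Θ)`** (`F̈⁰ → F̈⁰/F̈¹` hits `log(Θ)`). [cite: MochizukiEtTh2009, Prop 1.5 (ii) p.23] -/
theorem res_zClassYddχ_eq_logTheta (hC : (ThetaSetting.modelχ p).Compat) :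
    ContH1.res (MonoidHom.id (CurveTheta.GTheta (curveχ p))) (ThetaSetting.modelχ p).DeltaTheta
      (hC.deltaTheta_le_DtpYddTheta.trans (Subgroup.map_mono inf_le_left)) (zClassYddχ p) =
      (ThetaSetting.modelχ p).logTheta :=
  res_zClassχ_eq_logTheta p _ _

/-! ### Junction with abc-iut-L2-d1's theta class of the model (`SettingModelChiThetaCocycle`) -/

/-- **`infl zClassYχ = η^Θ(modelχ)`**: the `z`-class on `(Π^tp_Y)^Θ` inflates to abc-iut-L2-d1's theta class `etaχ` on
`Π^tp_Y` — the cocycles agree on the nose (`g·⟨b^{ŷ(g)}, g.right⟩⁻¹ = inl(centreRep g.left)`).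
[cite: MochizukiEtTh2009, Prop 1.3 p.20] -/
theorem inflTheta_zClassYχ :
    (ThetaSetting.modelχ p).inflTheta (ThetaSetting.modelχ p).GtpY (zClassYχ p) = etaχ p := by
  change ContH1.mk _ _ = ContH1.mk _ _
  refine ContH1.mk_congr _ (funext fun g => Subtype.ext ?_) _ _
  change CurveTheta.toTheta (curveχ p) (g : PiTpχ p) *
      (CurveTheta.toTheta (curveχ p) (refReprχ p (CurveTheta.toTheta (curveχ p) (g : PiTpχ p))))⁻¹ =
    CurveTheta.toTheta (curveχ p) (SemidirectProduct.inl (centreRep (g : PiTpχ p).left))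
  rw [← map_inv, ← map_mul, mul_refReprχ_inv_eq_inl]
  rfl

/-- **`infl zClassYddχ = η̈^Θ(modelχ)`** (abc-iut-L2-d1's `etaDdχ`). [cite: MochizukiEtTh2009, Prop 1.3 p.21] -/
theorem inflTheta_zClassYddχ :
    (ThetaSetting.modelχ p).inflTheta (ThetaSetting.modelχ p).GtpYdd (zClassYddχ p) = etaDdχ p := by
  rw [etaDdχ_eq_mk]
  change ContH1.mk _ _ = ContH1.mk _ _
  refine ContH1.mk_congr _ (funext fun g => Subtype.ext ?_) _ _
  change CurveTheta.toTheta (curveχ p) (g : PiTpχ p) *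
      (CurveTheta.toTheta (curveχ p) (refReprχ p (CurveTheta.toTheta (curveχ p) (g : PiTpχ p))))⁻¹ =
    CurveTheta.toTheta (curveχ p) (SemidirectProduct.inl (centreRep (g : PiTpχ p).left))
  rw [← map_inv, ← map_mul, mul_refReprχ_inv_eq_inl]
  rfl

/-- **`η̈^Θ(modelχ)` arises from a class on `(Π^tp_Ÿ)^Θ` restricting to `log(Θ)` on `Δ_Θ`** — the existence half of
the first clause of Prop. 1.5 (iii) at the model's own theta class (witness: `zClassYddχ`).
[cite: MochizukiEtTh2009, Prop 1.5 (iii) p.23] -/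
theorem exists_lift_etaDdχ (hC : (ThetaSetting.modelχ p).Compat) :
    ∃ x' : (ThetaSetting.modelχ p).H1Theta ((ThetaSetting.modelχ p).GtpYdd.map (ThetaSetting.modelχ p).toTheta),
      (ThetaSetting.modelχ p).inflTheta (ThetaSetting.modelχ p).GtpYdd x' = etaDdχ p ∧
      ContH1.res (MonoidHom.id (CurveTheta.GTheta (curveχ p))) (ThetaSetting.modelχ p).DeltaTheta
        (hC.deltaTheta_le_DtpYddTheta.trans (Subgroup.map_mono inf_le_left)) x' = (ThetaSetting.modelχ p).logTheta :=
  ⟨zClassYddχ p, inflTheta_zClassYddχ p, res_zClassYddχ_eq_logTheta p hC⟩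

/-- The same on `Y`: `η^Θ(modelχ)` arises from `zClassYχ`, which restricts to `log(Θ)`. [cite: MochizukiEtTh2009, Prop 1.5 (i) p.23] -/
theorem exists_lift_etaχ (hC : (ThetaSetting.modelχ p).Compat) :
    ∃ x' : (ThetaSetting.modelχ p).H1Theta ((ThetaSetting.modelχ p).GtpY.map (ThetaSetting.modelχ p).toTheta),
      (ThetaSetting.modelχ p).inflTheta (ThetaSetting.modelχ p).GtpY x' = etaχ p ∧
      ContH1.res (MonoidHom.id (CurveTheta.GTheta (curveχ p))) (ThetaSetting.modelχ p).DeltaTheta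
        (hC.deltaTheta_le_DtpYTheta.trans (Subgroup.map_mono inf_le_left)) x' = (ThetaSetting.modelχ p).logTheta :=
  ⟨zClassYχ p, inflTheta_zClassYχ p, res_zClassYχ_eq_logTheta p hC⟩

end Literature.AnabelianGeometry.EtaleTheta.SettingModel

end
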